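import Summits.HodgeConjecture.CorCM.GaloisQuaternionCyclicLift
import Mathlib.GroupTheory.SpecificGroups.Quaternion
import HarnessLib

/-!
# The quaternion–cyclic certificate lift with PREDICATE-ENCODED certificates (one numeral per set), and `Q₈ × C_p ↪ Gal(K/ℚ)`
# through `c` with `C_p` normal ⟹ BAD for `p = 17, 19, 37, 43` (the gen-28/29 norm pairs in balanced-set form)

COR-CM (cell `pub-hodgecm2`), binder seat b04 (gen 39), count-neutral own lane «Galois-CM-type classification» (blanket
`CorCM/GaloisQuaternion*`).  KERNEL ONLY: theorems (`decide +kernel` certificates); no definition, no named fact, no `sorry`.  `HC_CM`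
is neither used nor claimed.

For `|Q₈ × C_p| = 8p ≥ 296` a `Finset` literal of `4p` elements does not even elaborate within the default heartbeats.  §1 restates
gen 39's `exists_simple_degenerate_of_quaternion_cyclic_certificate` (`CorCM/GaloisQuaternionCyclicLift`) with the CM set and the
balanced set given by decidable PREDICATES; the instances encode each set by ONE numeral `N` (bit `idx(g)` of `N`, `idx(aⁱ, v) = i·p + v`,
`idx(x aⁱ, v) = (4 + i)·p + v`), so that `decide +kernel` costs `O(1)` GMP operations per membership (gen 29's trick).  The balanced
sets come from the gen-28/29 `μ₄`-norm pairs (`CorCM/GaloisQuaternionCyclicPrimeNormPairCertificates(B)`: two-sheet types with trivial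
stabilisers) by the shifted-difference annihilator `b = (σκ(v)·γ, σκ(u)·γ)`, `γ = 1 − ξ` of the seat notes (`scratch-g39/q2n/findD2.py`);
they are balanced over `C_p` automatically.  With `CorCM/GaloisOddPrimeShapesQuaternionBad.exists_simple_degenerate_of_shape_quaternion_of_certificate`'s
mechanism: the shapes Q× and QK of order `2ⁿ·p` are BAD for `p = 17, 19, 37, 43` as well (`p = 61`: the `244 + 112`-element certificate exceeds the default heartbeats in `decide +kernel`, left out) (`CorCM/GaloisOddPrimeShapesQuaternionBadB`).

References: Shimura (1998), §6.2 Thm. 3, §8.2 Prop. 26 [cite: Shimura1998]; Gordon (1999), Thm. 6.4, §9.3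
[cite: Gordon1999HodgeAVSurvey].
-/

noncomputable section

open CategoryTheory CategoryTheory.Limits NumberField
open scoped BigOperators

namespace Summit.HodgeConjecture.CorCM.GaloisModels

open Literature.NumberTheory.ComplexMultiplication
open Literature.AlgebraicGeometry.Motives (AbelianVariety CMType)
open Literature.AlgebraicGeometry.HodgeTheory
open Literature.AlgebraicGeometry.ComplexMultiplication (IsCMTypeRealisation)
open Literature.AlgebraicGeometry.Pohlmann1968
open Literature.Barriers.HodgeConjecture (divisorClassesSpan)
open Summit.HodgeConjecture.CorCM.GaloisRank
open QuaternionGroup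

variable {K : Type} [Field K] [NumberField K] [IsCMField K]

/-! ## §1 Predicate-encoded certificates -/

/-- **`Q_{4m} × C_p ↪ Gal(K/ℚ)` through `c` with `C_p` normal + a balanced certificate given by PREDICATES ⟹ BAD.**  `P` = the CM set,
`Q` = the balanced set (as decidable predicates on `Q_{4m} × C_p`); hypotheses as in
`exists_simple_degenerate_of_quaternion_cyclic_certificate`. [cite: Shimura1998, §6.2 Thm. 3 and §8.2 Prop. 26]
[cite: Gordon1999HodgeAVSurvey, Thm. 6.4 and §9.3] -/
theorem exists_simple_degenerate_of_quaternion_cyclic_certificate_pred [IsGalois ℚ K] {m p : ℕ} [NeZero m] [NeZero p]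
    (hm : 2 ≤ m) (hp : Odd p) (hp1 : p ≠ 1) (hcop : Nat.Coprime (4 * m) p) {A X u : K ≃ₐ[ℚ] K} (hA : orderOf A = 2 * m)
    (hX : X * X = A ^ m) (hXA : X * A * X⁻¹ = A⁻¹) (hc : A ^ m = (IsCMField.complexConj K).restrictScalars ℚ)
    (hu : orderOf u = p) (hAu : A * u = u * A) (hXu : X * u = u * X) (hnorm : (Subgroup.zpowers u).Normal)
    (P Q : QuaternionGroup m × Multiplicative (ZMod p) → Prop) [DecidablePred P] [DecidablePred Q]
    (hcm₁ : ∀ x, P x ↔ ¬ P (((a m, 1) : QuaternionGroup m × Multiplicative (ZMod p)) * x))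
    (hprim₁ : ∀ v : QuaternionGroup m × Multiplicative (ZMod p), v ≠ 1 → ∃ w, ¬ (P w ↔ P (v * w)))
    (hbal₁ : ∀ g : QuaternionGroup m × Multiplicative (ZMod p),
      2 * (Finset.univ.filter fun x => Q x ∧ P (x * g)).card = (Finset.univ.filter Q).card)
    (hmov₁ : ∃ x, Q x ∧ ¬ Q (((a m, 1) : QuaternionGroup m × Multiplicative (ZMod p)) * x))
    (hsym₁ : (Finset.univ.filter Q).val.map Prod.fst =
      (Finset.univ.filter Q).val.map fun x => (((a m, 1) : QuaternionGroup m × Multiplicative (ZMod p)) * x).1) :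
    ∃ (Φ : CMType K) (φ₀ : K →+* ℂ) (A : AbelianVariety ℂ) (ι : 𝓞 K →+* End A)
      (θ : K →+* Module.End ℂ (complexBetti A.X 1)),
      IsPrimitive (ℂ ≃+* ℂ) Φ.1 φ₀ ∧ ¬ IsNondegenerate Φ ∧ IsCMTypeRealisation Φ A ι θ ∧ A.IsSimple ∧
      A.dim = Module.finrank ℚ K / 2 ∧
      ∃ n p : ℕ, ∃ x : complexBetti (⨁ fun _ : Fin n => A).X (2 * p), IsRationalClass x ∧
        IsOfHodgeType (⨁ fun _ : Fin n => A).dim (⨁ fun _ : Fin n => A).X (2 * p) p p x ∧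
        x ∉ divisorClassesSpan (⨁ fun _ : Fin n => A).X (⨁ fun _ : Fin n => A).dim p := by
  classical
  refine exists_simple_degenerate_of_quaternion_cyclic_certificate hm hp hp1 hcop hA hX hXA hc hu hAu hXu hnorm
    (Finset.univ.filter P) (fun x => ?_) (fun v hv => ?_) (Finset.univ.filter Q) (fun g => ?_) ?_ ?_
  · simp only [Finset.mem_filter, Finset.mem_univ, true_and]
    exact hcm₁ x
  · obtain ⟨w, hw⟩ := hprim₁ v hv
    exact ⟨w, by simpa only [Finset.mem_filter, Finset.mem_univ, true_and] using hw⟩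
  · have : ((Finset.univ.filter Q).filter fun x => x * g ∈ Finset.univ.filter P) =
        Finset.univ.filter fun x => Q x ∧ P (x * g) := by
      ext x
      simp only [Finset.mem_filter, Finset.mem_univ, true_and]
    rw [this]
    exact hbal₁ g
  · obtain ⟨x, hx, hcx⟩ := hmov₁
    exact ⟨x, by simpa only [Finset.mem_filter, Finset.mem_univ, true_and] using hx,
      by simpa only [Finset.mem_filter, Finset.mem_univ, true_and] using hcx⟩
  · rw [Multiset.map_map]
    exact hsym₁

/-! ## §2 `p = 37` -/

set_option maxRecDepth 32000 in
/-- **`Q₈ × C₃₇ ↪ Gal(K/ℚ)` through `c`, `C₃₇` normal ⟹ BAD**: `ord A = 4`, `X² = A² = c`, `XAX⁻¹ = A⁻¹`, `ord u = 37`,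
`[A,u] = [X,u] = 1`, `⟨u⟩ ◁ Gal` (the gen-29 norm pair as a `148 + 68`-element balanced certificate, numeral-encoded, balanced over
`C₃₇`). [cite: Shimura1998, §6.2 Thm. 3 and §8.2 Prop. 26] [cite: Gordon1999HodgeAVSurvey, Thm. 6.4 and §9.3] -/
theorem exists_simple_degenerate_of_quaternionEight_cyclic37_subgroup [IsGalois ℚ K] {A X u : K ≃ₐ[ℚ] K}
    (hA : orderOf A = 4) (hX : X * X = A ^ 2) (hXA : X * A * X⁻¹ = A⁻¹)
    (hc : A ^ 2 = (IsCMField.complexConj K).restrictScalars ℚ) (hu : orderOf u = 37) (hAu : A * u = u * A)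
    (hXu : X * u = u * X) (hnorm : (Subgroup.zpowers u).Normal) :
    ∃ (Φ : CMType K) (φ₀ : K →+* ℂ) (A : AbelianVariety ℂ) (ι : 𝓞 K →+* End A)
      (θ : K →+* Module.End ℂ (complexBetti A.X 1)),
      IsPrimitive (ℂ ≃+* ℂ) Φ.1 φ₀ ∧ ¬ IsNondegenerate Φ ∧ IsCMTypeRealisation Φ A ι θ ∧ A.IsSimple ∧
      A.dim = Module.finrank ℚ K / 2 ∧
      ∃ n p : ℕ, ∃ x : complexBetti (⨁ fun _ : Fin n => A).X (2 * p), IsRationalClass x ∧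
        IsOfHodgeType (⨁ fun _ : Fin n => A).dim (⨁ fun _ : Fin n => A).X (2 * p) p p x ∧
        x ∉ divisorClassesSpan (⨁ fun _ : Fin n => A).X (⨁ fun _ : Fin n => A).dim p :=
  exists_simple_degenerate_of_quaternion_cyclic_certificate_pred (m := 2) (p := 37) le_rfl (by decide) (by decide) (by decide)
    hA hX hXA hc hu hAu hXu hnorm
    (fun g => 38603153281401640960614098115617362852640332183511318876420151688207434409982436776887323 / 2 ^ ((match g.1 with | a i => i.val | xa i => 4 + i.val) * 37 + (Multiplicative.toAdd g.2).val) % 2 = 1)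
    (fun g => 8524447293826961093086559372604517190204933322017502835708162385006053738143363590292800 / 2 ^ ((match g.1 with | a i => i.val | xa i => 4 + i.val) * 37 + (Multiplicative.toAdd g.2).val) % 2 = 1)
    (by decide +kernel) (by decide +kernel) (by decide +kernel) (by decide +kernel) (by decide +kernel)


/-! ## §3 `p = 17` -/

set_option maxRecDepth 32000 in
/-- **`Q₈ × C_17 ↪ Gal(K/ℚ)` through `c`, `C_17` normal ⟹ BAD**: `ord A = 4`, `X² = A² = c`, `XAX⁻¹ = A⁻¹`, `ord u = 17`,
`[A,u] = [X,u] = 1`, `⟨u⟩ ◁ Gal` (the gen-28 norm pair for `p = 17` as a `68 + 32`-element balanced certificate, numeral-encoded,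
balanced over `C_17`). [cite: Shimura1998, §6.2 Thm. 3 and §8.2 Prop. 26] [cite: Gordon1999HodgeAVSurvey, Thm. 6.4 and §9.3] -/
theorem exists_simple_degenerate_of_quaternionEight_cyclic17_subgroup [IsGalois ℚ K] {A X u : K ≃ₐ[ℚ] K}
    (hA : orderOf A = 4) (hX : X * X = A ^ 2) (hXA : X * A * X⁻¹ = A⁻¹)
    (hc : A ^ 2 = (IsCMField.complexConj K).restrictScalars ℚ) (hu : orderOf u = 17) (hAu : A * u = u * A)
    (hXu : X * u = u * X) (hnorm : (Subgroup.zpowers u).Normal) :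
    ∃ (Φ : CMType K) (φ₀ : K →+* ℂ) (A : AbelianVariety ℂ) (ι : 𝓞 K →+* End A)
      (θ : K →+* Module.End ℂ (complexBetti A.X 1)),
      IsPrimitive (ℂ ≃+* ℂ) Φ.1 φ₀ ∧ ¬ IsNondegenerate Φ ∧ IsCMTypeRealisation Φ A ι θ ∧ A.IsSimple ∧
      A.dim = Module.finrank ℚ K / 2 ∧
      ∃ n p : ℕ, ∃ x : complexBetti (⨁ fun _ : Fin n => A).X (2 * p), IsRationalClass x ∧
        IsOfHodgeType (⨁ fun _ : Fin n => A).dim (⨁ fun _ : Fin n => A).X (2 * p) p p x ∧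
        x ∉ divisorClassesSpan (⨁ fun _ : Fin n => A).X (⨁ fun _ : Fin n => A).dim p :=
  exists_simple_degenerate_of_quaternion_cyclic_certificate_pred (m := 2) (p := 17) le_rfl (by decide) (by decide) (by decide)
    hA hX hXA hc hu hAu hXu hnorm
    (fun g => 64810536309566706796331958264705082681503 / 2 ^ ((match g.1 with | a i => i.val | xa i => 4 + i.val) * 17 + (Multiplicative.toAdd g.2).val) % 2 = 1)
    (fun g => 45300137193417288408042972491581974938882 / 2 ^ ((match g.1 with | a i => i.val | xa i => 4 + i.val) * 17 + (Multiplicative.toAdd g.2).val) % 2 = 1)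
    (by decide +kernel) (by decide +kernel) (by decide +kernel) (by decide +kernel) (by decide +kernel)

/-! ## §4 `p = 19` -/

set_option maxRecDepth 32000 in
/-- **`Q₈ × C_19 ↪ Gal(K/ℚ)` through `c`, `C_19` normal ⟹ BAD**: `ord A = 4`, `X² = A² = c`, `XAX⁻¹ = A⁻¹`, `ord u = 19`,
`[A,u] = [X,u] = 1`, `⟨u⟩ ◁ Gal` (the gen-28 norm pair for `p = 19` as a `76 + 36`-element balanced certificate, numeral-encoded,
balanced over `C_19`). [cite: Shimura1998, §6.2 Thm. 3 and §8.2 Prop. 26] [cite: Gordon1999HodgeAVSurvey, Thm. 6.4 and §9.3] -/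
theorem exists_simple_degenerate_of_quaternionEight_cyclic19_subgroup [IsGalois ℚ K] {A X u : K ≃ₐ[ℚ] K}
    (hA : orderOf A = 4) (hX : X * X = A ^ 2) (hXA : X * A * X⁻¹ = A⁻¹)
    (hc : A ^ 2 = (IsCMField.complexConj K).restrictScalars ℚ) (hu : orderOf u = 19) (hAu : A * u = u * A)
    (hXu : X * u = u * X) (hnorm : (Subgroup.zpowers u).Normal) :
    ∃ (Φ : CMType K) (φ₀ : K →+* ℂ) (A : AbelianVariety ℂ) (ι : 𝓞 K →+* End A)
      (θ : K →+* Module.End ℂ (complexBetti A.X 1)),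
      IsPrimitive (ℂ ≃+* ℂ) Φ.1 φ₀ ∧ ¬ IsNondegenerate Φ ∧ IsCMTypeRealisation Φ A ι θ ∧ A.IsSimple ∧
      A.dim = Module.finrank ℚ K / 2 ∧
      ∃ n p : ℕ, ∃ x : complexBetti (⨁ fun _ : Fin n => A).X (2 * p), IsRationalClass x ∧
        IsOfHodgeType (⨁ fun _ : Fin n => A).dim (⨁ fun _ : Fin n => A).X (2 * p) p p x ∧
        x ∉ divisorClassesSpan (⨁ fun _ : Fin n => A).X (⨁ fun _ : Fin n => A).dim p :=
  exists_simple_degenerate_of_quaternion_cyclic_certificate_pred (m := 2) (p := 19) le_rfl (by decide) (by decide) (by decide)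
    hA hX hXA hc hu hAu hXu hnorm
    (fun g => 3941927813614141062158799310104118981364092149 / 2 ^ ((match g.1 with | a i => i.val | xa i => 4 + i.val) * 19 + (Multiplicative.toAdd g.2).val) % 2 = 1)
    (fun g => 1474746055443232212450124420292313192086392900 / 2 ^ ((match g.1 with | a i => i.val | xa i => 4 + i.val) * 19 + (Multiplicative.toAdd g.2).val) % 2 = 1)
    (by decide +kernel) (by decide +kernel) (by decide +kernel) (by decide +kernel) (by decide +kernel)

/-! ## §5 `p = 43` -/

set_option maxRecDepth 32000 in
/-- **`Q₈ × C_43 ↪ Gal(K/ℚ)` through `c`, `C_43` normal ⟹ BAD**: `ord A = 4`, `X² = A² = c`, `XAX⁻¹ = A⁻¹`, `ord u = 43`,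
`[A,u] = [X,u] = 1`, `⟨u⟩ ◁ Gal` (the gen-29 norm pair for `p = 43` as a `172 + 80`-element balanced certificate, numeral-encoded,
balanced over `C_43`). [cite: Shimura1998, §6.2 Thm. 3 and §8.2 Prop. 26] [cite: Gordon1999HodgeAVSurvey, Thm. 6.4 and §9.3] -/
theorem exists_simple_degenerate_of_quaternionEight_cyclic43_subgroup [IsGalois ℚ K] {A X u : K ≃ₐ[ℚ] K}
    (hA : orderOf A = 4) (hX : X * X = A ^ 2) (hXA : X * A * X⁻¹ = A⁻¹)
    (hc : A ^ 2 = (IsCMField.complexConj K).restrictScalars ℚ) (hu : orderOf u = 43) (hAu : A * u = u * A)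
    (hXu : X * u = u * X) (hnorm : (Subgroup.zpowers u).Normal) :
    ∃ (Φ : CMType K) (φ₀ : K →+* ℂ) (A : AbelianVariety ℂ) (ι : 𝓞 K →+* End A)
      (θ : K →+* Module.End ℂ (complexBetti A.X 1)),
      IsPrimitive (ℂ ≃+* ℂ) Φ.1 φ₀ ∧ ¬ IsNondegenerate Φ ∧ IsCMTypeRealisation Φ A ι θ ∧ A.IsSimple ∧
      A.dim = Module.finrank ℚ K / 2 ∧
      ∃ n p : ℕ, ∃ x : complexBetti (⨁ fun _ : Fin n => A).X (2 * p), IsRationalClass x ∧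
        IsOfHodgeType (⨁ fun _ : Fin n => A).dim (⨁ fun _ : Fin n => A).X (2 * p) p p x ∧
        x ∉ divisorClassesSpan (⨁ fun _ : Fin n => A).X (⨁ fun _ : Fin n => A).dim p :=
  exists_simple_degenerate_of_quaternion_cyclic_certificate_pred (m := 2) (p := 43) le_rfl (by decide) (by decide) (by decide)
    hA hX hXA hc hu hAu hXu hnorm
    (fun g => 16948180551508210184596702430362453909791813107765986445058092929889868453146193930107491775174452218579 / 2 ^ ((match g.1 with | a i => i.val | xa i => 4 + i.val) * 43 + (Multiplicative.toAdd g.2).val) % 2 = 1)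
    (fun g => 4763904768961883016832167419205529194803326117230589433001981858122398097365115492897538002820166407173 / 2 ^ ((match g.1 with | a i => i.val | xa i => 4 + i.val) * 43 + (Multiplicative.toAdd g.2).val) % 2 = 1)
    (by decide +kernel) (by decide +kernel) (by decide +kernel) (by decide +kernel) (by decide +kernel)


end Summit.HodgeConjecture.CorCM.GaloisModels

end
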